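import Mathlib
import Summits.ValiantsHypothesis.ValiantsHypothesis.Theses.FifoMatching
import Summits.ValiantsHypothesis.ValiantsHypothesis.Theorems.FifoMatchingNNNotVPSupportFnCore
import Summits.ValiantsHypothesis.ValiantsHypothesis.Theorems.FifoMatchingNNNotVPStubSupportFnHard
import Summits.ValiantsHypothesis.ValiantsHypothesis.Theorems.FifoMatchingNNNotVPStubCertificateToSupportFn
import Summits.ValiantsHypothesis.ValiantsHypothesis.Theorems.FifoMatchingNNDivisionHardSpreadDenseDeepResidual
import Literature.Computability.AlgebraicComplexity.NestFreeMatchingPoly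
import HarnessLib

/-!
# Route FifoMatching — crux `NNDivisionHard` (stmt-ValiantsHypothesis-21181):
# the BOOLEAN-SHADOW DOMINATION rung, and the residual enemy class refined BY NAME

Over `ℝ≥0` there is no cancellation, so the support function (Boolean shadow) of a product splits:
`SuppFn (f · h) A ↔ SuppFn f A ∧ SuppFn h A` (`suppFn_mul_iff`; `SuppFn g A` = «some monomial of `g`
uses only variables of `A`» = «`g(1_A) ≠ 0`»).  Consequently, whenever the shadow of the cofactor is
IMPLIED by the shadow of `NN_n` — «every arc set carrying a nest-free perfect matching carries the support
of a monomial of `h`» (`h` is *dominated*) — the certificate `NN_n · h` has EXACTLY the support function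
of `NN_n`, i.e. it still decides nest-free-perfect-matching existence (= shuffle-square recognition), and
the landed stub A of line `division_split` (`NNNotVP.DivisionSplit.stub_supportFnHard`, ✓ p821759: every
nonnegative polynomial with the support function of `NN_n` with `≤ (log₂ n + k)^k` arcs freed has
`L₊ > 2^((log₂ n + c)^c)`, eventually) prices it.  The same holds after freeing any polylogarithmic arc set
`T` on both sides (`freeVars T`, a free projection: `complexity_freeVars_le`, `freeVars_mul`).

Results (all sorry-free, no definitions, no named facts):

* `suppFn_mul_iff` — the shadow of a product over `ℝ≥0`.
* `nnDivisionHard_of_freedDominated` — **THE RUNG**: for all `k c`, eventually in `n`, for every cofactor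
  `h` and every arc set `T` with `|T| ≤ (log₂ n + k)^k`: if `∀ A, SuppFn (NN_n|_{T:=1}) A → SuppFn (h|_{T:=1}) A`
  then `2^((log₂ n + c)^c) < L₊(NN_n · h) + L₊(h)`.
* `nnDivisionHard_of_dominated` — the case `T = ∅`.
* `freedDominated_of_mem_support` — a monomial `x^m` of `h` makes `h|_{supp m := 1}` dominated (it has a
  nonzero constant term), so the rung SUBSUMES the landed small-support-monomial rung
  (`NNDivisionHard.Residual.nnDivisionHard_of_smallSupportMonomial` = B1 ∘ A, `T := supp m`); dually
  `spread_of_undominated`: undominated cofactors are spread.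
* `nnDivisionHard_iff_undominatedResidual` — BY NAME: `Theses.FifoMatching.NNDivisionHard` ⟺ its
  restriction to cofactors that are CHEAP ∧ WINDOW-DENSE ∧ DEEP ∧ SPREAD (the landed residual
  `nnDivisionHard_iff_spreadDenseDeepResidual`, ✓ p822526) ∧ **UNDOMINATED**: for EVERY arc set `T` of
  `≤ (log₂ n + k)^k` arcs there is an arc set `A` such that `T ∪ A` carries a nest-free perfect matching
  but carries the support of NO monomial of `h` — the Boolean shadow of a surviving enemy cofactor must
  CUT INTO the shuffle-square language at every polylogarithmic set of free arcs.

What the rung decides (examples, not formalised): every product of powers of «covering» linear forms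
`Π_W (Σ_{e ∋ W} x_e)^{D_W}` over vertex windows `W` (cheap by repeated squaring, window-dense, deep and
spread — a member of the previous residual — but dominated, since a perfect matching touches every
window), `(Σ_e x_e)^D · g` for any `g ≠ 0` with a constant term, and every `h + h'` with `h` dominated
(domination is monotone in the support).  What it does not decide: cofactors supported on a proper
sub-language, e.g. `(x^{M₀})^D` for one matching `M₀` (decided elsewhere by the monomial-cofactor rungs)
or sums over few matchings.

Honest framing: one more decided sub-population of 21181 by the Boolean reduction (the NN-instance of
`Cruxes/ZeroOneTransfer/Disproof.lean` §2(i), where — unlike for `per` — the monotone Boolean bound IS a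
tree theorem, g3's CLIQUE-hardness of nest-free-perfect-matching existence); the undominated residual,
`NNDivisionHard`, `NNNotVP` and `VP ≠ VNP` stay OPEN (NOT proved).
-/

noncomputable section

-- Sub = Summit single-conjunct layout: the duplicated namespace component is mandated by the tree.
set_option linter.dupNamespace false
set_option autoImplicit false

namespace Summit.ValiantsHypothesis.ValiantsHypothesis.Theorems.FifoMatching.NNDivisionHard.ShadowDominated

open MvPolynomial Finset Literature.Computability.AlgebraicComplexity
open scoped NNReal BigOperators Classical
open Summit.ValiantsHypothesis.ValiantsHypothesis.Theorems.FifoMatching.NNNotVP.DivisionSplit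
  (σ NN SuppFn freeVars stub_supportFnHard suppFn_iff_eval_ne_zero freeVars_mul freeVars_empty
    complexity_freeVars_le zero_mem_support_freeVars)
open Summit.ValiantsHypothesis.ValiantsHypothesis.Theorems.FifoMatching.NNDivisionHard.Residual
  (nnDivisionHard_iff_spreadDenseDeepResidual)

/-! ### §1 The shadow of a product -/

/-- **The Boolean shadow of a product over `ℝ≥0`**: `SuppFn (f · g) A ↔ SuppFn f A ∧ SuppFn g A`
(both sides read `(f·g)(1_A) ≠ 0`, and `ℝ≥0` has no zero divisors). [folklore] -/
theorem suppFn_mul_iff {τ : Type*} (f g : MvPolynomial τ ℝ≥0) (A : Finset τ) :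
    SuppFn (f * g) A ↔ SuppFn f A ∧ SuppFn g A := by
  rw [suppFn_iff_eval_ne_zero, suppFn_iff_eval_ne_zero, suppFn_iff_eval_ne_zero, map_mul,
    mul_ne_zero_iff]

/-- A dominated cofactor does not change the shadow of the certificate:
if `∀ A, SuppFn f A → SuppFn g A` then `SuppFn (f · g) A ↔ SuppFn f A`. [folklore] -/
theorem suppFn_mul_iff_left_of_dominated {τ : Type*} {f g : MvPolynomial τ ℝ≥0}
    (hdom : ∀ A : Finset τ, SuppFn f A → SuppFn g A) (A : Finset τ) :
    SuppFn (f * g) A ↔ SuppFn f A := by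
  rw [suppFn_mul_iff]
  exact ⟨fun h => h.1, fun h => ⟨h, hdom A h⟩⟩

/-! ### §2 The domination rung -/

/-- **THE BOOLEAN-SHADOW DOMINATION RUNG of `NNDivisionHard`.**  For all `k c`, eventually in `n`:
for every cofactor `h` and every arc set `T` with `|T| ≤ (log₂ n + k)^k`, if the shadow of `h|_{T:=1}`
is implied by the shadow of `NN_n|_{T:=1}` (every arc set carrying a nest-free perfect matching with
the arcs of `T` free carries, with the same arcs free, the support of a monomial of `h`), then
`2^((log₂ n + c)^c) < L₊(NN_n · h) + L₊(h)`.  Proof: `g := (NN_n · h)|_{T:=1} = NN_n|_{T:=1} · h|_{T:=1}`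
has the shadow of `NN_n|_{T:=1}` (`suppFn_mul_iff_left_of_dominated`), so stub A prices it above
`2^((log₂ n + c)^c)`, and freeing arcs is a free projection (`L₊(g) ≤ L₊(NN_n · h)`). [folklore] -/
theorem nnDivisionHard_of_freedDominated (k c : ℕ) :
    ∃ n₀ : ℕ, ∀ n ≥ n₀, ∀ h : MvPolynomial (Fin (2 * n) × Fin (2 * n)) ℝ≥0, ∀ T : Finset (σ n),
      T.card ≤ (Nat.log 2 n + k) ^ k →
      (∀ A : Finset (σ n), SuppFn (freeVars T (NN n)) A → SuppFn (freeVars T h) A) →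
      2 ^ ((Nat.log 2 n + c) ^ c) < complexity (nestFreeMatchingPoly n ℝ≥0 * h) + complexity h := by
  obtain ⟨n₀, hn₀⟩ := stub_supportFnHard k c
  refine ⟨n₀, fun n hn h T hT hdom => ?_⟩
  have hg : ∀ A : Finset (σ n),
      SuppFn (freeVars T (NN n * h)) A ↔ SuppFn (freeVars T (NN n)) A := by
    intro A
    rw [freeVars_mul]
    exact suppFn_mul_iff_left_of_dominated hdom A
  calc 2 ^ ((Nat.log 2 n + c) ^ c) < complexity (freeVars T (NN n * h)) := hn₀ n hn T hT _ hg
    _ ≤ complexity (NN n * h) := complexity_freeVars_le _ _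
    _ ≤ complexity (nestFreeMatchingPoly n ℝ≥0 * h) + complexity h := Nat.le_add_right _ _

/-- **The case `T = ∅`**: for every `c`, eventually in `n`, every cofactor whose shadow is implied by
nest-free-perfect-matching existence (`∀ A, SuppFn NN_n A → SuppFn h A`) has
`2^((log₂ n + c)^c) < L₊(NN_n · h) + L₊(h)`. [folklore] -/
theorem nnDivisionHard_of_dominated (c : ℕ) :
    ∃ n₀ : ℕ, ∀ n ≥ n₀, ∀ h : MvPolynomial (Fin (2 * n) × Fin (2 * n)) ℝ≥0,
      (∀ A : Finset (σ n), SuppFn (NN n) A → SuppFn h A) →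
      2 ^ ((Nat.log 2 n + c) ^ c) < complexity (nestFreeMatchingPoly n ℝ≥0 * h) + complexity h := by
  obtain ⟨n₀, hn₀⟩ := nnDivisionHard_of_freedDominated 0 c
  refine ⟨n₀, fun n hn h hdom => hn₀ n hn h ∅ (by simp) fun A => ?_⟩
  rw [freeVars_empty, freeVars_empty]
  exact hdom A

/-! ### §3 The rung subsumes the small-support-monomial rung -/

/-- **A monomial of `h` makes `h` dominated once its arcs are freed**: if `x^m ∈ supp h` then
`h|_{supp m := 1}` has a nonzero constant term (`zero_mem_support_freeVars`), so its shadow is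
identically true. [folklore] -/
theorem freedDominated_of_mem_support {n : ℕ} (h : MvPolynomial (Fin (2 * n) × Fin (2 * n)) ℝ≥0)
    {m : σ n →₀ ℕ} (hm : m ∈ h.support) :
    ∀ A : Finset (σ n), SuppFn (freeVars m.support (NN n)) A → SuppFn (freeVars m.support h) A := by
  intro A _
  exact ⟨0, zero_mem_support_freeVars h m hm, by simp⟩

/-- **Undominated cofactors are spread**: if for every `T` of `≤ (log₂ n + k)^k` arcs some arc set
witnesses non-domination of `h|_{T:=1}`, then every monomial of `h` uses more than `(log₂ n + k)^k`
distinct arcs. [folklore] -/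
theorem spread_of_undominated {n k : ℕ} (h : MvPolynomial (Fin (2 * n) × Fin (2 * n)) ℝ≥0)
    (hund : ∀ T : Finset (σ n), T.card ≤ (Nat.log 2 n + k) ^ k →
      ∃ A : Finset (σ n), SuppFn (freeVars T (NN n)) A ∧ ¬ SuppFn (freeVars T h) A) :
    ∀ d ∈ h.support, (Nat.log 2 n + k) ^ k < d.support.card := by
  intro d hd
  by_contra hle
  obtain ⟨A, hA, hnot⟩ := hund d.support (not_lt.mp hle)
  exact hnot (freedDominated_of_mem_support h hd A hA)

/-! ### §4 The residual enemy class of 21181, refined BY NAME -/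

/-- **`NNDivisionHard` ⟺ `NNDivisionHard` for CHEAP, WINDOW-DENSE, DEEP, SPREAD and UNDOMINATED
cofactors.**  For all `k, c`, eventually in `n`, it suffices to treat the nonzero `h` with
`L₊(h) ≤ 2^((log₂ n + c)^c)` (cheap), every monomial meeting every window of
`2·((log₂ n + c)^c + log₂ n + 1)^6 + 12` consecutive vertices (window-dense), all homogeneous components
of degree `≤ 2^((log₂ n + k)^k)` zero (deep), every monomial using more than `(log₂ n + k)^k` distinct
arcs (spread), AND for every arc set `T` of `≤ (log₂ n + k)^k` arcs some arc set `A` with a nest-free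
perfect matching inside `T ∪ A` but the support of no monomial of `h` inside `T ∪ A` (undominated;
`SuppFn (freeVars T g) A ↔ SuppFn g (T ∪ A)` is the landed `suppFn_freeVars_iff`).  The other
cofactors are decided by the landed residual `nnDivisionHard_iff_spreadDenseDeepResidual` and the
domination rung `nnDivisionHard_of_freedDominated`.  (`NN_n` inlined in the route decl is
definitionally `nestFreeMatchingPoly n ℝ≥0`.) [folklore] -/
theorem nnDivisionHard_iff_undominatedResidual :
    Summit.ValiantsHypothesis.ValiantsHypothesis.Theses.FifoMatching.NNDivisionHard ↔
      ∀ k c : ℕ, ∃ n₀ : ℕ, ∀ n ≥ n₀, ∀ h : MvPolynomial (Fin (2 * n) × Fin (2 * n)) ℝ≥0, h ≠ 0 →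
        complexity h ≤ 2 ^ ((Nat.log 2 n + c) ^ c) →
        (∀ d ∈ h.support, ∀ s : ℕ,
          s + (2 * ((Nat.log 2 n + c) ^ c + Nat.log 2 n + 1) ^ 6 + 12) ≤ 2 * n →
          ∃ e ∈ d.support,
            (s ≤ e.1.val ∧ e.1.val < s + (2 * ((Nat.log 2 n + c) ^ c + Nat.log 2 n + 1) ^ 6 + 12)) ∨
            (s ≤ e.2.val ∧ e.2.val < s + (2 * ((Nat.log 2 n + c) ^ c + Nat.log 2 n + 1) ^ 6 + 12))) →
        (∀ e : ℕ, e ≤ 2 ^ ((Nat.log 2 n + k) ^ k) → homogeneousComponent e h = 0) →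
        (∀ d ∈ h.support, (Nat.log 2 n + k) ^ k < d.support.card) →
        (∀ T : Finset (σ n), T.card ≤ (Nat.log 2 n + k) ^ k →
          ∃ A : Finset (σ n), SuppFn (freeVars T (NN n)) A ∧ ¬ SuppFn (freeVars T h) A) →
        2 ^ ((Nat.log 2 n + c) ^ c) <
          complexity (nestFreeMatchingPoly n ℝ≥0 * h) + complexity h := by
  constructor
  · intro H k c
    obtain ⟨n₀, hn₀⟩ := H c
    exact ⟨n₀, fun n hn h hh _ _ _ _ _ => hn₀ n hn h hh⟩
  · intro H
    refine nnDivisionHard_iff_spreadDenseDeepResidual.mpr fun k c => ?_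
    obtain ⟨n₁, hn₁⟩ := H k c
    obtain ⟨n₂, hn₂⟩ := nnDivisionHard_of_freedDominated k c
    refine ⟨max n₁ n₂, fun n hn h hh hcheap hdense hdeep hspread => ?_⟩
    by_cases hdom : ∃ T : Finset (σ n), T.card ≤ (Nat.log 2 n + k) ^ k ∧
        ∀ A : Finset (σ n), SuppFn (freeVars T (NN n)) A → SuppFn (freeVars T h) A
    · obtain ⟨T, hT, hTdom⟩ := hdom
      exact hn₂ n (le_of_max_le_right hn) h T hT hTdom
    · refine hn₁ n (le_of_max_le_left hn) h hh hcheap hdense hdeep hspread fun T hT => ?_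
      by_contra hno
      refine hdom ⟨T, hT, fun A hA => ?_⟩
      by_contra hnot
      exact hno ⟨A, hA, hnot⟩

/-- **What the parent crux `NNNotVP` (stmt-11615) hinges on after this rung, BY NAME**: the 0/1
division transfer `Theses.DivisionGap.ZeroOneTransfer` (stmt-5066; by the landed
`NNNotVP.TransferAtNN.nnNotVP_iff_transferAtNN_of_nnDivisionHard` only its instance at `NN` is consumed)
and the undominated residual give `NNNotVP` (landed glue `NNNotVPSplit.nnNotVP_of_subs`).  Both
hypotheses are OPEN. [folklore] -/
theorem nnNotVP_of_zeroOneTransfer_of_undominatedResidual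
    (hZ : Summit.ValiantsHypothesis.ValiantsHypothesis.Theses.DivisionGap.ZeroOneTransfer)
    (hR : ∀ k c : ℕ, ∃ n₀ : ℕ, ∀ n ≥ n₀, ∀ h : MvPolynomial (Fin (2 * n) × Fin (2 * n)) ℝ≥0, h ≠ 0 →
        complexity h ≤ 2 ^ ((Nat.log 2 n + c) ^ c) →
        (∀ d ∈ h.support, ∀ s : ℕ,
          s + (2 * ((Nat.log 2 n + c) ^ c + Nat.log 2 n + 1) ^ 6 + 12) ≤ 2 * n →
          ∃ e ∈ d.support,
            (s ≤ e.1.val ∧ e.1.val < s + (2 * ((Nat.log 2 n + c) ^ c + Nat.log 2 n + 1) ^ 6 + 12)) ∨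
            (s ≤ e.2.val ∧ e.2.val < s + (2 * ((Nat.log 2 n + c) ^ c + Nat.log 2 n + 1) ^ 6 + 12))) →
        (∀ e : ℕ, e ≤ 2 ^ ((Nat.log 2 n + k) ^ k) → homogeneousComponent e h = 0) →
        (∀ d ∈ h.support, (Nat.log 2 n + k) ^ k < d.support.card) →
        (∀ T : Finset (σ n), T.card ≤ (Nat.log 2 n + k) ^ k →
          ∃ A : Finset (σ n), SuppFn (freeVars T (NN n)) A ∧ ¬ SuppFn (freeVars T h) A) →
        2 ^ ((Nat.log 2 n + c) ^ c) <
          complexity (nestFreeMatchingPoly n ℝ≥0 * h) + complexity h) :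
    Summit.ValiantsHypothesis.ValiantsHypothesis.Theses.FifoMatching.NNNotVP :=
  Summit.ValiantsHypothesis.ValiantsHypothesis.Theorems.FifoMatching.NNNotVPSplit.nnNotVP_of_zeroOneTransfer hZ
    (nnDivisionHard_iff_undominatedResidual.mpr hR)

end Summit.ValiantsHypothesis.ValiantsHypothesis.Theorems.FifoMatching.NNDivisionHard.ShadowDominated

end
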